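import Mathlib.AlgebraicGeometry.EllipticCurve.IsomOfJ
import Literature.NumberTheory.EllipticCurves.LegendreFormValuation
import HarnessLib

/-!
# The Legendre good model: potential good reduction realised over an algebraically closed valued
# field of residue characteristic `≠ 2` (Silverman, *AEC*, Prop. VII.5.5, as printed)

Topic `NumberTheory/EllipticCurves`. Our formalisation of the PRINTED proof of Silverman, *AEC*,
Prop. VII.5.5 (`⇐`: integral `j` ⟹ potential good reduction) for residue characteristic `≠ 2`,
which goes through the LEGENDRE form (proof of Prop. VII.5.4 (c), PDF pp. 176–177: over a field
where `2 ≠ 0` an elliptic curve has a Legendre equation `y² = x(x − 1)(x − λ)`, `λ ≠ 0, 1`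
(Prop. III.1.7); if `|j| ≤ 1` then `λ ≢ 0, 1 (mod 𝔪)` and the Legendre equation is integral with
unit discriminant `16λ²(λ − 1)²`). It is the `|2| = 1` twin of the tree's Deuring-form theorem
`exists_variableChange_eq_baseChange_isUnit_Δ_of_val_j_le_one` (`|3| = 1`, Appendix A Prop. 1.3,
file `HasseWeilAbelianConductorSwanIndependenceTwoProofs`), needed at places above `3`.

Contents (theorems only; the Legendre equation is the literal Weierstrass equation
`⟨0, -(1 + λ), 0, λ, 0⟩` of `LegendreFormValuation`):

* `legendre_isElliptic_iff` — `⟨0, -(1 + λ), 0, λ, 0⟩` is elliptic iff `λ ≠ 0` and `λ ≠ 1`;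
* `legendre_j_mul` — `j · (λ² (λ − 1)²) = 256 (λ² − λ + 1)³`;
* `exists_legendre_j_eq` — over a separably closed field with `2 ≠ 0`, every `j` is the
  `j`-invariant of an (elliptic) Legendre equation (a root `λ` of the sextic
  `256 (λ² − λ + 1)³ − j λ² (λ − 1)²`, which has neither `0` nor `1` as a root);
* `exists_variableChange_eq_baseChange_isUnit_Δ_of_val_j_le_one_of_val_two` — **the Legendre
  good model**: `L` algebraically closed with a valuation `w`, `w 2 = 1`, `X/L` elliptic with
  `w (j X) ≤ 1` ⟹ `∃ C W₀, C • X = W₀.baseChange L ∧ IsUnit W₀.Δ` (`W₀` over `w.integer`).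

## References

* [SilvermanAEC2009] J. H. Silverman, *The Arithmetic of Elliptic Curves*, 2nd ed., GTM 106,
  Springer 2009: Prop. III.1.7 (Legendre form) and its proof (PDF pp. 53–54), proof of
  Prop. VII.5.4 (c) and Prop. VII.5.5 (PDF pp. 176–177), Prop. III.1.4 (b) (`j` classifies up to
  isomorphism over an algebraically closed field; Mathlib `WeierstrassCurve.exists_variableChange_of_j_eq`).
-/

noncomputable section

open scoped NNReal

universe u

namespace Literature.NumberTheory.EllipticCurves

open _root_.WeierstrassCurve _root_.Polynomial

section Legendre

variable {F : Type u} [Field F]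

/-- The Legendre equation `y² = x(x − 1)(x − λ)` is an elliptic curve iff `λ ≠ 0, 1`
(`Δ = 16 λ² (λ − 1)²`; needs `2 ≠ 0`). Silverman, *AEC*, Prop. III.1.7.
[cite: SilvermanAEC2009, Prop. III.1.7] -/
theorem legendre_isElliptic_iff (h2 : (2 : F) ≠ 0) (la : F) :
    (⟨0, -(1 + la), 0, la, 0⟩ : WeierstrassCurve F).IsElliptic ↔ la ≠ 0 ∧ la ≠ 1 := by
  rw [WeierstrassCurve.isElliptic_iff, legendre_Δ, isUnit_iff_ne_zero]
  have h16 : (16 : F) ≠ 0 := by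
    rw [show (16 : F) = 2 ^ 4 by norm_num]; exact pow_ne_zero _ h2
  constructor
  · intro h
    refine ⟨fun h0 ↦ h ?_, fun h1 ↦ h ?_⟩
    · rw [h0]; ring
    · rw [h1]; ring
  · rintro ⟨h0, h1⟩
    exact mul_ne_zero (mul_ne_zero h16 (pow_ne_zero _ h0)) (pow_ne_zero _ (sub_ne_zero.mpr h1))

/-- `j · (λ² (λ − 1)²) = 256 (λ² − λ + 1)³` for an elliptic Legendre equation
(`j = 2⁸ (λ² − λ + 1)³ / (λ² (λ − 1)²)`). Silverman, *AEC*, Prop. III.1.7 (b).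
[cite: SilvermanAEC2009, Prop. III.1.7 (b)] -/
theorem legendre_j_mul (h2 : (2 : F) ≠ 0) (la : F)
    [hE : (⟨0, -(1 + la), 0, la, 0⟩ : WeierstrassCurve F).IsElliptic] :
    (⟨0, -(1 + la), 0, la, 0⟩ : WeierstrassCurve F).j * (la ^ 2 * (la - 1) ^ 2) =
      256 * (la ^ 2 - la + 1) ^ 3 := by
  set V : WeierstrassCurve F := ⟨0, -(1 + la), 0, la, 0⟩ with hV
  have h16 : (16 : F) ≠ 0 := by
    rw [show (16 : F) = 2 ^ 4 by norm_num]; exact pow_ne_zero _ h2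
  have hΔ : V.Δ = 16 * la ^ 2 * (la - 1) ^ 2 := legendre_Δ la
  have hc₄ : V.c₄ = 16 * (la ^ 2 - la + 1) := legendre_c₄ la
  have hΔ0 : V.Δ ≠ 0 := hE.isUnit.ne_zero
  have hjΔ : V.j * V.Δ = V.c₄ ^ 3 := by
    rw [WeierstrassCurve.j, Units.val_inv_eq_inv_val, coe_Δ', mul_comm, ← mul_assoc,
      mul_inv_cancel₀ hΔ0, one_mul]
  rw [hΔ, hc₄] at hjΔ
  apply mul_left_cancel₀ h16
  linear_combination hjΔ

/-- Over a separably closed field with `2 ≠ 0`, every `j ∈ F` is the `j`-invariant of an ELLIPTIC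
Legendre equation `y² = x(x − 1)(x − λ)`: take `λ` a root of the separable-closed-solvable sextic
`256 (X² − X + 1)³ − j X² (X − 1)²` (degree `6`, leading coefficient `256 ≠ 0`), which vanishes at
neither `0` nor `1` (value `256`). Silverman, *AEC*, Prop. III.1.7 with III.1.4 (c) (proof idea).
[cite: SilvermanAEC2009, Prop. III.1.7 and Prop. III.1.4 (c)] -/
theorem exists_legendre_j_eq [IsAlgClosed F] (h2 : (2 : F) ≠ 0) (j₀ : F) :
    ∃ la : F, ∃ _ : (⟨0, -(1 + la), 0, la, 0⟩ : WeierstrassCurve F).IsElliptic,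
      (⟨0, -(1 + la), 0, la, 0⟩ : WeierstrassCurve F).j = j₀ := by
  -- the sextic `f = 256 (X² − X + 1)³ − j₀ X² (X − 1)²`
  set f : F[X] := C 256 * (X ^ 2 - X + 1) ^ 3 - C j₀ * (X ^ 2 * (X - 1) ^ 2) with hf
  have h256 : (256 : F) ≠ 0 := by
    rw [show (256 : F) = 2 ^ 8 by norm_num]; exact pow_ne_zero _ h2
  have hcub : (X ^ 2 - X + 1 : F[X]).natDegree = 2 := by compute_degree!
  have hA : (C 256 * (X ^ 2 - X + 1) ^ 3 : F[X]).natDegree = 6 := by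
    rw [natDegree_C_mul h256, natDegree_pow, hcub]
  have hB : (C j₀ * (X ^ 2 * (X - 1) ^ 2) : F[X]).natDegree ≤ 4 := by
    calc (C j₀ * (X ^ 2 * (X - 1) ^ 2) : F[X]).natDegree
        ≤ (C j₀).natDegree + (X ^ 2 * (X - 1) ^ 2 : F[X]).natDegree := natDegree_mul_le
      _ ≤ 0 + (2 + 2) := by
          gcongr
          · exact (natDegree_C _).le
          · calc (X ^ 2 * (X - 1) ^ 2 : F[X]).natDegree
                ≤ (X ^ 2 : F[X]).natDegree + ((X - 1) ^ 2 : F[X]).natDegree := natDegree_mul_le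
              _ ≤ 2 + 2 := by
                  gcongr
                  · exact (natDegree_X_pow_le 2)
                  · calc ((X - 1) ^ 2 : F[X]).natDegree ≤ 2 * (X - 1 : F[X]).natDegree :=
                        natDegree_pow_le
                      _ ≤ 2 * 1 := by gcongr; exact (natDegree_X_sub_C (1 : F)).le
                      _ = 2 := by norm_num
      _ = 4 := by norm_num
  have hdeg : f.natDegree = 6 := by
    rw [hf, natDegree_sub_eq_left_of_natDegree_lt (by rw [hA]; omega), hA]
  have hf0 : f ≠ 0 := fun h ↦ by rw [h, natDegree_zero] at hdeg; exact absurd hdeg (by norm_num)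
  have hdeg' : f.degree ≠ 0 := by
    rw [degree_eq_natDegree hf0, hdeg]; exact_mod_cast (by norm_num)
  obtain ⟨la, hla⟩ := IsAlgClosed.exists_root f hdeg'
  have hval : f.eval la = 256 * (la ^ 2 - la + 1) ^ 3 - j₀ * (la ^ 2 * (la - 1) ^ 2) := by
    simp [hf]
  rw [IsRoot.def, hval, sub_eq_zero] at hla
  have hla0 : la ≠ 0 := by
    rintro rfl; apply h256; simpa using hla
  have hla1 : la ≠ 1 := by
    rintro rfl; apply h256; simpa using hla
  haveI hE : (⟨0, -(1 + la), 0, la, 0⟩ : WeierstrassCurve F).IsElliptic :=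
    (legendre_isElliptic_iff h2 la).mpr ⟨hla0, hla1⟩
  refine ⟨la, hE, ?_⟩
  have hne : (la ^ 2 * (la - 1) ^ 2 : F) ≠ 0 :=
    mul_ne_zero (pow_ne_zero _ hla0) (pow_ne_zero _ (sub_ne_zero.mpr hla1))
  have key := legendre_j_mul h2 la
  rw [hla] at key
  exact mul_right_cancel₀ hne key

variable {L : Type u} [Field L]

/-- **The Legendre good model** (potential good reduction realised over `K̄_v`, residue
characteristic `≠ 2`). Let `L` be an algebraically closed field with a valuation `w` such that
`w 2 = 1`, and `X/L` an elliptic curve with `w (j X) ≤ 1`. Then some change of variables over `L`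
transforms `X` into the base change of an equation `W₀` over the valuation ring `𝒪_w` with unit
discriminant: `W₀` is a Legendre equation `y² = x(x − 1)(x − λ)` with `j = j(X)`
(`exists_legendre_j_eq`), whose parameter satisfies `|λ| = |λ − 1| = 1` since otherwise `|j| > 1`
(`one_lt_val_j_legendre`), hence is integral with `|Δ| = 1` (`isIntegral_legendre_of_val`); it is
`L`-isomorphic to `X` (Mathlib `WeierstrassCurve.exists_variableChange_of_j_eq`, *AEC* III.1.4 (b)).
Silverman, *AEC*, Prop. VII.5.5 (`⇐`) exactly as printed (via the Legendre form, proof of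
Prop. VII.5.4 (c)); the `|3| = 1` Deuring twin is
`exists_variableChange_eq_baseChange_isUnit_Δ_of_val_j_le_one`.
[cite: SilvermanAEC2009, Prop. VII.5.5 with the proof of Prop. VII.5.4 (c) (PDF pp. 176–177), Prop. III.1.7, Prop. III.1.4 (b)] -/
theorem exists_variableChange_eq_baseChange_isUnit_Δ_of_val_j_le_one_of_val_two [IsAlgClosed L]
    {w : Valuation L ℝ≥0} (h2 : w 2 = 1) (X : WeierstrassCurve L) [X.IsElliptic]
    (hj : w X.j ≤ 1) :
    ∃ (C : VariableChange L) (W₀ : WeierstrassCurve w.integer),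
      C • X = W₀.baseChange L ∧ IsUnit W₀.Δ := by
  have h2L : (2 : L) ≠ 0 := fun h ↦ by simp [h] at h2
  obtain ⟨la, hE, hjla⟩ := exists_legendre_j_eq h2L X.j
  -- `|λ| = |λ - 1| = 1`, else `|j| > 1`
  have hgood : w la = 1 ∧ w (la - 1) = 1 := by
    by_contra h
    have h1 := one_lt_val_j_legendre (w := w) h2 (la := la) h
    rw [hjla] at h1
    exact absurd hj (not_le.mpr h1)
  obtain ⟨hint, hwΔ⟩ := isIntegral_legendre_of_val h2 hgood.1 hgood.2
  obtain ⟨W₀, hW₀'⟩ := hint.integral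
  obtain ⟨C, hC⟩ := WeierstrassCurve.exists_variableChange_of_j_eq X
    (⟨0, -(1 + la), 0, la, 0⟩ : WeierstrassCurve L) hjla.symm
  refine ⟨C, W₀, hC.trans hW₀', (Valuation.integer.integers w).isUnit_of_one' ?_⟩
  change w ((algebraMap w.integer L) W₀.Δ) = 1
  rw [← map_Δ]
  change w (W₀.baseChange L).Δ = 1
  rw [← hW₀']
  exact hwΔ

end Legendre

end Literature.NumberTheory.EllipticCurves

end
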